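import Mathlib.AlgebraicGeometry.Gluing
import Mathlib.AlgebraicGeometry.Limits
import Mathlib.Topology.LocallyConstant.Basic
import HarnessLib

/-!
# Gluing morphisms over a PARTITION into open subschemes (no compatibility condition), and maps out of `Y ×_S ∐ M`

Layer `Literature/AlgebraicGeometry/Morphisms`, namespace `Literature.AlgebraicGeometry.Morphisms`.  Mathlib only.  Theorems only: no
definition, no named fact, no instance, no notation, no `sorry`.

When an open cover has pairwise EMPTY overlaps (a partition of the scheme into open — hence clopen — pieces), Mathlib's
`Scheme.Cover.glueMorphisms` needs no compatibility data: morphisms on the pieces glue UNIQUELY.  Three instances used by the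
Hom-scheme assembly ([MumfordFogartyKirwan1994] Ch. 0 §5 (c): `Hom_S(Y, X) = ∐_P (…)`, a test scheme being decomposed by the Hilbert
polynomial of the graph):

* `existsUnique_glue_of_pairwise_isEmpty` — for ANY open cover `𝒰` of `T` with `𝒰_i ×_T 𝒰_j = ∅` (`i ≠ j`) and morphisms
  `w i : 𝒰_i → M`: `∃! g : T → M` with `𝒰.f i ≫ g = w i`.
* `isEmpty_pullback_ι_of_disjoint`, `existsUnique_glue_of_disjoint_iSup_eq_top` — the case of a family of pairwise disjoint opens
  `U : σ → T.Opens` covering `T`; `iSup_fiber_eq_top_of_isLocallyConstant`, `disjoint_fiber` — the level sets of a locally constant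
  function form such a partition (Mathlib `IsLocallyConstant.isClopen_fiber`).
* `isEmpty_of_hom`, `existsUnique_glue_pullback_sigmaDesc` — maps out of `pullback q (Sigma.desc m)` (`q : Y → S`,
  `m i : M i → S`) glue uniquely from the pieces `pullback q (Sigma.ι M i ≫ Sigma.desc m)` (Mathlib `Scheme.Pullback.openCoverOfRight`
  of `sigmaOpenCover`; overlaps empty by `isEmpty_pullback_sigmaι_of_ne`).

Cell hodgecm-mathlib, F-4 (II-b) Hom-scheme assembly, sub-letter (D) «gluing» of the child line `F4IIbHomScheme` (B-p14 (g20) skeleton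
v0.2), B-p14 (g20).  Count-neutral capital, Mathlib-upstreamable: HC_CM is proved only modulo the 7 printed citations until rung 0 closes;
nothing here bears on it.

## References

* The Stacks Project, Tag 01JB (disjoint unions ∕ gluing of schemes) and Tag 01KH. [StacksProject]
* D. Mumford, J. Fogarty, F. Kirwan, *Geometric Invariant Theory* (3rd ed., 1994), Ch. 0 §5 (c) (p. 23). [MumfordFogartyKirwan1994]
-/

noncomputable section

set_option backward.isDefEq.respectTransparency false

open CategoryTheory CategoryTheory.Limits AlgebraicGeometry TopologicalSpace

universe v u

namespace Literature.AlgebraicGeometry.Morphisms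

/-! ## §1 Gluing without compatibility over a cover with empty overlaps -/

/-- A scheme mapping to an empty scheme is empty. [cite: StacksProject, Tag 01JB] -/
theorem isEmpty_of_hom {X Y : Scheme.{u}} (f : X ⟶ Y) [h : IsEmpty ↥Y] : IsEmpty ↥X :=
  ⟨fun x => h.false (f.base x)⟩

/-- **Gluing morphisms over an open cover with pairwise EMPTY overlaps needs no compatibility**: for `𝒰` an open cover of `T` with
`𝒰_i ×_T 𝒰_j` empty for `i ≠ j` and any morphisms `w i : 𝒰_i → M`, there is a UNIQUE `g : T → M` with `𝒰.f i ≫ g = w i` (Mathlib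
`Scheme.Cover.glueMorphisms`: on `𝒰_i ×_T 𝒰_i` the two projections agree since `𝒰.f i` is a monomorphism; uniqueness by
`Scheme.Cover.hom_ext`). [cite: StacksProject, Tag 01JB] -/
theorem existsUnique_glue_of_pairwise_isEmpty {T M : Scheme.{u}} (𝒰 : T.OpenCover)
    (h : ∀ i j : 𝒰.I₀, i ≠ j → IsEmpty ↥(pullback (𝒰.f i) (𝒰.f j))) (w : ∀ i, 𝒰.X i ⟶ M) :
    ∃! g : T ⟶ M, ∀ i, 𝒰.f i ≫ g = w i := by
  have hf : ∀ i j, pullback.fst (𝒰.f i) (𝒰.f j) ≫ w i = pullback.snd _ _ ≫ w j := by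
    intro i j
    by_cases hij : i = j
    · subst hij
      rw [fst_eq_snd_of_mono_eq]
    · haveI := h i j hij
      exact (isInitialOfIsEmpty (X := pullback (𝒰.f i) (𝒰.f j))).hom_ext _ _
  refine ⟨Scheme.Cover.glueMorphisms 𝒰 w hf, fun i => Scheme.Cover.ι_glueMorphisms 𝒰 w hf i, fun g hg => ?_⟩
  exact Scheme.Cover.hom_ext 𝒰 _ _ fun i => by rw [hg i, Scheme.Cover.ι_glueMorphisms]

/-! ## §2 Partitions into open subschemes -/

/-- Disjoint opens have empty fibre product of their inclusions (the fibre product of two open immersions is their intersection).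
[cite: StacksProject, Tag 01JB] -/
theorem isEmpty_pullback_ι_of_disjoint {T : Scheme.{u}} {U V : T.Opens} (hUV : Disjoint U V) :
    IsEmpty ↥(pullback U.ι V.ι) := by
  refine ⟨fun z => ?_⟩
  have h₁ : (pullback.fst U.ι V.ι ≫ U.ι).base z ∈ (U : Set T) := by
    rw [Scheme.Hom.comp_base, TopCat.coe_comp, Function.comp_apply]
    exact ((pullback.fst U.ι V.ι).base z).2
  have h₂ : (pullback.fst U.ι V.ι ≫ U.ι).base z ∈ (V : Set T) := by
    rw [pullback.condition, Scheme.Hom.comp_base, TopCat.coe_comp, Function.comp_apply]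
    exact ((pullback.snd U.ι V.ι).base z).2
  exact Set.disjoint_iff.mp (Opens.coe_disjoint.mpr hUV) ⟨h₁, h₂⟩

/-- **Morphisms on the pieces of a partition into open subschemes glue uniquely**: for pairwise disjoint opens `U : σ → T.Opens` covering
`T` and morphisms `w i : U i → M`, there is a unique `g : T → M` with `(U i).ι ≫ g = w i` for all `i`. [cite: StacksProject, Tag 01JB] -/
theorem existsUnique_glue_of_disjoint_iSup_eq_top {T M : Scheme.{u}} {σ : Type v} (U : σ → T.Opens)
    (hdisj : ∀ i j, i ≠ j → Disjoint (U i) (U j)) (hcov : ⨆ i, U i = ⊤) (w : ∀ i, (U i : Scheme.{u}) ⟶ M) :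
    ∃! g : T ⟶ M, ∀ i, (U i).ι ≫ g = w i :=
  existsUnique_glue_of_pairwise_isEmpty (T.openCoverOfIsOpenCover U hcov)
    (fun i j hij => isEmpty_pullback_ι_of_disjoint (hdisj i j hij)) w

/-- The level sets of a locally constant function on a scheme are open and COVER it. [cite: StacksProject, Tag 01JB] -/
theorem iSup_fiber_eq_top_of_isLocallyConstant {T : Scheme.{u}} {σ : Type v} {P : ↥T → σ} (hP : IsLocallyConstant P) :
    ⨆ Q : σ, (⟨P ⁻¹' {Q}, (hP.isClopen_fiber Q).isOpen⟩ : T.Opens) = ⊤ := by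
  refine top_le_iff.mp fun t _ => ?_
  rw [Opens.mem_iSup]
  exact ⟨P t, rfl⟩

/-- … and are pairwise DISJOINT. [cite: StacksProject, Tag 01JB] -/
theorem disjoint_fiber {T : Scheme.{u}} {σ : Type v} {P : ↥T → σ} (hP : IsLocallyConstant P) {Q Q' : σ} (hQ : Q ≠ Q') :
    Disjoint (⟨P ⁻¹' {Q}, (hP.isClopen_fiber Q).isOpen⟩ : T.Opens) ⟨P ⁻¹' {Q'}, (hP.isClopen_fiber Q').isOpen⟩ := by
  rw [← Opens.coe_disjoint, Set.disjoint_iff]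
  rintro t ⟨h₁, h₂⟩
  exact hQ ((Set.mem_singleton_iff.mp h₁).symm.trans (Set.mem_singleton_iff.mp h₂))

/-- **Gluing over the level sets of a locally constant function**: morphisms `w Q : {P = Q} → M` glue to a unique `g : T → M`.
[cite: StacksProject, Tag 01JB] -/
theorem existsUnique_glue_of_isLocallyConstant {T M : Scheme.{u}} {σ : Type v} {P : ↥T → σ} (hP : IsLocallyConstant P)
    (w : ∀ Q : σ, ((⟨P ⁻¹' {Q}, (hP.isClopen_fiber Q).isOpen⟩ : T.Opens) : Scheme.{u}) ⟶ M) :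
    ∃! g : T ⟶ M, ∀ Q, Scheme.Opens.ι (⟨P ⁻¹' {Q}, (hP.isClopen_fiber Q).isOpen⟩ : T.Opens) ≫ g = w Q :=
  existsUnique_glue_of_disjoint_iSup_eq_top _ (fun _ _ h => disjoint_fiber hP h) (iSup_fiber_eq_top_of_isLocallyConstant hP) w

/-! ## §3 Maps out of `Y ×_S ∐ M` -/

/-- **Morphisms out of `pullback q (Sigma.desc m)` glue uniquely from the pieces `pullback q (Sigma.ι M i ≫ Sigma.desc m) = Y ×_S M i`**
(no compatibility: the pieces of Mathlib's `Scheme.Pullback.openCoverOfRight (sigmaOpenCover M) q (Sigma.desc m)` have empty pairwise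
overlaps, which map to the empty `M i ×_{∐ M} M j`, Mathlib `isEmpty_pullback_sigmaι_of_ne`).  This builds the universal morphism `u`
of the Hom-scheme on `Y ×_S ∐_P M_P` from the `u_P`. [cite: StacksProject, Tag 01JB] [cite: MumfordFogartyKirwan1994, Ch. 0 §5 (c) (p. 23)] -/
theorem existsUnique_glue_pullback_sigmaDesc {S Y Z : Scheme.{u}} {σ : Type u} (M : σ → Scheme.{u}) (q : Y ⟶ S)
    (m : ∀ i, M i ⟶ S) (u : ∀ i, pullback q (Sigma.ι M i ≫ Sigma.desc m) ⟶ Z) :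
    ∃! g : pullback q (Sigma.desc m) ⟶ Z, ∀ i,
      pullback.map q (Sigma.ι M i ≫ Sigma.desc m) q (Sigma.desc m) (𝟙 Y) (Sigma.ι M i) (𝟙 S)
        (by rw [Category.comp_id, Category.id_comp]) (Category.comp_id _) ≫ g = u i := by
  let 𝒰 := Scheme.Pullback.openCoverOfRight (sigmaOpenCover M) q (Sigma.desc m)
  -- the cover maps are the `pullback.map` of the statement
  have h𝒰 : ∀ i : σ, 𝒰.f i = pullback.map q (Sigma.ι M i ≫ Sigma.desc m) q (Sigma.desc m) (𝟙 Y) (Sigma.ι M i) (𝟙 S)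
      (by rw [Category.comp_id, Category.id_comp]) (Category.comp_id _) := fun i => rfl
  have hsnd : ∀ i : σ, 𝒰.f i ≫ pullback.snd q (Sigma.desc m) = pullback.snd q (Sigma.ι M i ≫ Sigma.desc m) ≫ Sigma.ι M i :=
    fun i => by rw [h𝒰, pullback.lift_snd]
  have hempty : ∀ i j : 𝒰.I₀, i ≠ j → IsEmpty ↥(pullback (𝒰.f i) (𝒰.f j)) := by
    intro i j hij
    haveI : IsEmpty ↥(pullback (Sigma.ι M i) (Sigma.ι M j)) := isEmpty_pullback_sigmaι_of_ne M hij
    -- `𝒰_i ×_{Y ×_S ∐M} 𝒰_j` maps to `M i ×_{∐ M} M j = ∅`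
    exact isEmpty_of_hom (pullback.map (𝒰.f i) (𝒰.f j) (Sigma.ι M i) (Sigma.ι M j)
      (pullback.snd q (Sigma.ι M i ≫ Sigma.desc m)) (pullback.snd q (Sigma.ι M j ≫ Sigma.desc m))
      (pullback.snd q (Sigma.desc m)) (hsnd i) (hsnd j))
  obtain ⟨g, hg, huniq⟩ := existsUnique_glue_of_pairwise_isEmpty 𝒰 hempty (fun i => u i)
  refine ⟨g, fun i => ?_, fun g' hg' => huniq g' fun i => ?_⟩
  · rw [← h𝒰]; exact hg i
  · rw [h𝒰]; exact hg' i

end Literature.AlgebraicGeometry.Morphisms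

end
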